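import Summits.Schanuel.Schanuel.Theses.RoyCriterion
import Literature.NumberTheory.Transcendental.RoySmallValueMain
import Summits.Schanuel.Schanuel.Theorems.RoyCriterionRoySmallValueDirichletGapDefs
import Summits.Schanuel.Schanuel.Theorems.RoyCriterionRoySmallValueDirichletGapStubTwoSidedAbsorptionLemmas

/-!
# Route `RoyCriterion`, crux `RoySmallValueDirichletGap` (stmt-Schanuel-1050), line
# `two-sided-absorption-transfer` — stub `StubTwoSidedAbsorption`

**What is proved.** `RoyLinks.stub_twoSidedAbsorption` (registered stub of the line): for
`1 < τ < 2`, `τ < β`, `0 < δ < τ − 1` and every constant `C > 0` there is `c > 0` such that, for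
all large `D`, every enemy link `IsLink C ξ η β τ δ D P h D*` (the line's currency for Roy's enemy
`Z_D`: a finite set `P ⊂ ℂ³` born at the level `D* < D`, with the size, Liouville, mass and Step-4
clauses) is ABSORBED (`Absorbs`) at every level `D'` of the two-sided range
`D^{1−δ/(τ−1)}/c ≤ D' ≤ c·D^{1+δ/β}`: every integer point `R ∈ ℤ[X]_{D'}` of Roy's body
`𝒞_{D'} = royBody D' ξ η (2D'^β) (D'^ν/2) ⌊D'^τ⌋`, `ν = 2 + β − τ + δ`, vanishes on `P`.

**Proof (Roy 2013, §7, Steps 2, 4, 5, run two-sidedly).** Suppose `R ∈ 𝒞_{D'} ∩ ℤ[X]` does not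
vanish at a point of `P`.  By the Liouville clause it vanishes at no point of `P` and
`0 ≤ D' h + ∑_P log(|R(p)|/‖p‖^{D'})`; the crude bound `|R(u_p)| ≤ 3^{D'} e^{2D'^β}`, Prop. 4.2 at
the near points and the glue `Roy2013.step4_sum_max_ge'` (`absorb_step4_points`) give
`−∑_{p∈𝒮} leafCloseness T' p ≤ D' h + 6 #P D'^β` (`T' = ⌊D'^τ⌋`) for the set `𝒮 ⊆ P ∩ 𝒰` of near
points with negative closeness at depth `T = ⌊D^τ⌋` (`absorb_neg_sum_leafCloseness_le`; the sizes
`#P ≤ C (D*)^{2−τ} ≤ C D'^{2−τ}`, `h ≤ C D'^{1+β−τ}` come from `D* < D'`, itself from Step 5 (ii),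
`IsLink.rpow_Ds_le`, and the lower end of the range).  On the other side the mass clause at the
single level `D`, `∑_{P∩𝒰} leafCloseness T ≤ −(D^δ/C)(D^β #P + D h)`, propagates to depth `T'`
(`leafCloseness_absorb_descent`: factor `T'/T` below `D`; `leafCloseness_absorb_ascent`: no loss
above `D`), and the two pure-real inequalities `absorb_contra_down` / `absorb_contra_up` show that
the propagated mass beats `D' h + 6 #P D'^β` on the whole range — a contradiction.  Roy uses this
only at `D' = D*`; the two-sided range is the line's new lever (card F2).

**Design.** The vocabulary (`IsLink`, `Absorbs`, `leafCloseness`, `IsNear`, …) is the line's Defs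
file; the vocabulary-free helpers (thresholds, constants, the two real contradictions, Step 4 for a
finite point set) are in `…StubTwoSidedAbsorptionLemmas`.

## References

* [Roy2013] D. Roy, *A small value estimate for 𝔾ₐ × 𝔾ₘ*, Mathematika 59 (2013), 333–363
  (arXiv:1301.0663), §7, Steps 2, 4, 5; Propositions 2.4, 4.2; Lemma 4.1.
-/

-- `Summit.Schanuel.Schanuel.…` is the mandated layout of this single-problem summit (CONVENTIONS §1).
set_option linter.dupNamespace false

noncomputable section

namespace Summit.Schanuel.Schanuel.Theorems.RoyLinks

open Filter MvPolynomial Finset Height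
open Literature.NumberTheory.Transcendental
open Literature.NumberTheory.Transcendental.Roy2013
open Summit.Schanuel.Schanuel.Theses.RoyCriterion (RoySmallValueDirichletGap)

/-! ## Propagation of the closeness between depths -/

/-- DESCENT propagation of one point's Step-2 term: for `0 ≤ T' ≤ T`, `T > 0` and `log ε ≤ 0`:
`max(T' log ρ, log ε) ≤ (T'/T) · max(T log ρ, log ε)`. [folklore] -/
theorem absorb_max_rescale_le {T T' lρ lε : ℝ} (hT : 0 < T) (hTT : T' ≤ T) (hT' : 0 ≤ T')
    (hε : lε ≤ 0) : max (T' * lρ) lε ≤ (T' / T) * max (T * lρ) lε := by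
  have hq0 : 0 ≤ T' / T := div_nonneg hT' hT.le
  have hq1 : T' / T ≤ 1 := (div_le_one hT).mpr hTT
  have h1 : (T' / T) * (T * lρ) = T' * lρ := by field_simp
  have h2 : lε ≤ (T' / T) * lε := by nlinarith
  calc max (T' * lρ) lε ≤ max (T' * lρ) ((T' / T) * lε) := max_le_max le_rfl h2
    _ = max ((T' / T) * (T * lρ)) ((T' / T) * lε) := by rw [h1]
    _ = (T' / T) * max (T * lρ) lε := (mul_max_of_nonneg _ _ hq0).symm

/-- DESCENT of one point's closeness: for `0 < T`, `T' ≤ T` and a point `p` with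
`leafCloseness T p < 0`: `leafCloseness T' p ≤ (T'/T) · leafCloseness T p`.
[cite: Roy2013, §7, Step 2 (the summand); card two-sided-absorption-transfer] -/
theorem leafCloseness_absorb_descent {ξ η : ℂ} {T T' : ℕ} {p : Fin 3 → ℂ} (hT : 0 < T)
    (hTT : T' ≤ T) (hneg : leafCloseness ξ η T p < 0) :
    leafCloseness ξ η T' p ≤ (T' : ℝ) / T * leafCloseness ξ η T p := by
  have hTr : (0 : ℝ) < T := by exact_mod_cast hT
  have hTTr : (T' : ℝ) ≤ T := by exact_mod_cast hTT
  unfold leafCloseness at hneg ⊢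
  split_ifs at hneg ⊢ with hq
  · exact absorb_max_rescale_le hTr hTTr (Nat.cast_nonneg _) ((le_max_right _ _).trans_lt hneg).le
  · rw [max_self, max_self]
    have e : (T' : ℝ) / T * (T * Real.log (pdist ξ η (supNormalise p))) =
        T' * Real.log (pdist ξ η (supNormalise p)) := by
      field_simp
    exact e.symm.le

/-- ASCENT of one near point's closeness: for `T ≤ T'` and a near point `p` (`log dist ≤ 0`),
`leafCloseness T' p ≤ leafCloseness T p`. [cite: Roy2013, §7, Step 2 (the summand)] -/
theorem leafCloseness_absorb_ascent {ξ η : ℂ} {T T' : ℕ} {p : Fin 3 → ℂ} (hTT : T ≤ T')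
    (hnear : IsNear ξ η p) : leafCloseness ξ η T' p ≤ leafCloseness ξ η T p := by
  have hρ := log_pdist_nonpos_of_isNear hnear
  have hTTr : (T : ℝ) ≤ T' := by exact_mod_cast hTT
  have hmono : (T' : ℝ) * Real.log (pdist ξ η (supNormalise p)) ≤
      T * Real.log (pdist ξ η (supNormalise p)) := mul_le_mul_of_nonpos_right hTTr hρ
  unfold leafCloseness
  split_ifs with hq
  · exact max_le_max hmono le_rfl
  · rw [max_self, max_self]; exact hmono

/-! ## Roy's Step 4 at the level `D'` on a link -/

/-- **Roy's Step 4 run at the level `D'` on the points of a link born below `D'`** (sizes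
`#P ≤ C₁ (D')^{2−τ}`, `h ≤ C₁ (D')^{1+β−τ}`; thresholds (b), (c) at `D'`): for an integer point `R`
of the body `𝒞_{D'}` vanishing at no point of `P` (so that Liouville holds) and every `𝒮 ⊆ P ∩ 𝒰`,
`−∑_{p∈𝒮} leafCloseness T' p ≤ D' h + 6 #P (D')^β`, `T' = ⌊(D')^τ⌋`.
[cite: Roy2013, §7, Step 4; Prop. 4.2; Lemma 4.1] -/
theorem absorb_neg_sum_leafCloseness_le {ξ η : ℂ} {β τ δ C₁ h : ℝ} {D' : ℕ}
    {P S : Finset (Fin 3 → ℂ)} {R : MvPolynomial (Fin 3) ℤ}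
    (hRmem : map (Int.castRingHom ℂ) R ∈
      royBody D' ξ η (2 * (D' : ℝ) ^ β) ((D' : ℝ) ^ (2 + β - τ + δ) / 2) ⌊(D' : ℝ) ^ τ⌋₊)
    (hP0 : ∀ p ∈ P, p ≠ 0) (hpos : ∀ p ∈ P, 0 < pdist ξ η (supNormalise p))
    (hall : ∀ p ∈ P, aeval p R ≠ 0)
    (hLio : 0 ≤ D' * h + ∑ p ∈ P, Real.log (‖aeval p R‖ / ‖p‖ ^ D'))
    (hS : S ⊆ P.filter (IsNear ξ η))
    (hcard' : (#P : ℝ) ≤ C₁ * (D' : ℝ) ^ (2 - τ)) (hh' : h ≤ C₁ * (D' : ℝ) ^ (1 + β - τ))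
    (hbig' : Real.log 2 + 2 * roy_c2 ξ η ^ 2 + (D' : ℝ) * (C₁ * (D' : ℝ) ^ (1 + β - τ)) +
      C₁ * (D' : ℝ) ^ (2 - τ) * ((D' : ℝ) * Real.log 3 + 2 * (D' : ℝ) ^ β) <
        (D' : ℝ) ^ (2 + β - τ + δ) / 2)
    (hconst : 2 * (D' : ℝ) * Real.log 3 + Real.log 4 + (D' : ℝ) * Real.log (roy_c4 ξ η) ≤
      2 * (D' : ℝ) ^ β) :
    -(∑ p ∈ S, leafCloseness ξ η ⌊(D' : ℝ) ^ τ⌋₊ p) ≤ D' * h + 6 * #P * (D' : ℝ) ^ β := by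
  have hD'0 : (0 : ℝ) ≤ D' := Nat.cast_nonneg _
  have hSP : S ⊆ P := hS.trans (filter_subset _ _)
  have hlog3 : 0 < Real.log 3 := Real.log_pos (by norm_num)
  have hY : 0 ≤ (D' : ℝ) * Real.log 3 + 2 * (D' : ℝ) ^ β := by positivity
  have hbig : Real.log 2 + 2 * roy_c2 ξ η ^ 2 - (D' : ℝ) ^ (2 + β - τ + δ) / 2 <
      -(D' * h + #P * (D' * Real.log 3 + 2 * (D' : ℝ) ^ β)) := by
    have t1 : (D' : ℝ) * h ≤ D' * (C₁ * (D' : ℝ) ^ (1 + β - τ)) :=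
      mul_le_mul_of_nonneg_left hh' hD'0
    have t2 : (#P : ℝ) * (D' * Real.log 3 + 2 * (D' : ℝ) ^ β) ≤
        C₁ * (D' : ℝ) ^ (2 - τ) * (D' * Real.log 3 + 2 * (D' : ℝ) ^ β) :=
      mul_le_mul_of_nonneg_right hcard' hY
    linarith
  have h4 := absorb_step4_points hRmem hP0 hall hLio hSP (fun p hp => (mem_filter.mp (hS hp)).2)
    (fun p hp => hpos p (hSP hp)) hY hbig
  change _ ≤ ∑ p ∈ S, leafCloseness ξ η ⌊(D' : ℝ) ^ τ⌋₊ p at h4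
  -- the constant: `(D' log 3 + 2(D')^β) + log(4M) ≤ 6 (D')^β`, `log(4M) ≥ 0`, `#S ≤ #P`
  obtain ⟨hL0, e2⟩ := absorbConst_bounds hconst
  have hSP' : (#S : ℝ) ≤ #P := by exact_mod_cast card_le_card hSP
  have e1 := mul_le_mul_of_nonneg_right hSP' hL0
  have e3 := mul_le_mul_of_nonneg_left e2 (Nat.cast_nonneg #P)
  linarith

/-! ## Stub `StubTwoSidedAbsorption` -/

/-- **Two-sided strong absorption (the lever of line `two-sided-absorption-transfer`).**
For every constant `C` there is `c > 0` such that, for all large `D`, every enemy link of level `D`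
with constant `C` is absorbed at EVERY level `D'` with `D^{1−δ/(τ−1)}/c ≤ D' ≤ c·D^{1+δ/β}`: all
integer points of Roy's body `𝒞_{D'}` vanish on it (`0 < δ < τ − 1`).
[cite: Roy2013, §7 Steps 2–5, Props 2.4, 4.2, Lemma 4.1;
card two-sided-absorption-transfer F2 (new)] -/
theorem stub_twoSidedAbsorption (ξ η : ℂ) (β τ δ C : ℝ) (h1 : 1 < τ) (h2 : τ < 2)
    (hβ : τ < β) (hδ : 0 < δ) (hδτ : δ < τ - 1) (hC : 0 < C) :
    ∃ c : ℝ, 0 < c ∧ ∀ᶠ D : ℕ in atTop,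
      ∀ (P : Finset (Fin 3 → ℂ)) (h : ℝ) (Ds : ℕ), IsLink C ξ η β τ δ D P h Ds →
        ∀ D' : ℕ, (D : ℝ) ^ (1 - δ / (τ - 1)) / c ≤ D' → (D' : ℝ) ≤ c * (D : ℝ) ^ (1 + δ / β) →
          Absorbs ξ η β τ δ D' P := by
  /- ── constants: `C₁ = max C 1`, `c = (12 C₁²)^{−1/(τ−1)}` ── -/
  obtain ⟨C₁, hC₁⟩ : ∃ C₁ : ℝ, C₁ = max C 1 := ⟨_, rfl⟩
  have hC1 : 1 ≤ C₁ := hC₁ ▸ le_max_right _ _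
  have hCC₁ : C ≤ C₁ := hC₁ ▸ le_max_left _ _
  have hC₁0 : 0 < C₁ := hC.trans_le hCC₁
  have hτ10 : 0 < τ - 1 := by linarith
  have hτ0 : 0 ≤ τ := by linarith
  have hβ1 : 1 < β := by linarith
  obtain ⟨c, hc0, hc12, hcpow⟩ := exists_absorbRange_const h1 h2 hC1
  refine ⟨c, hc0, ?_⟩
  /- ── thresholds in `D'` (via `N₁ ≤ D'`) and in `D` ── -/
  obtain ⟨N₁, hN₁⟩ := eventually_atTop.mp
    ((eventually_absorb_big (Real.log 2 + 2 * roy_c2 ξ η ^ 2) C₁ h1.le hβ hδ).and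
      (eventually_step4_const (c := Real.log (roy_c4 ξ η)) hβ1))
  have hθ : 0 < 1 - δ / (τ - 1) := by
    rw [sub_pos, div_lt_one hτ10]; exact hδτ
  filter_upwards [eventually_const_mul_rpow_le_rpow (6 * C₁ ^ 3) hδ,
    eventually_const_mul_rpow_le_rpow (24 * C₁) hδ,
    eventually_const_mul_rpow_le_rpow ((N₁ : ℝ) * c) hθ, eventually_ge_atTop 1]
    with D hd6 hd24 hdN hD1
  have hD1r : (1 : ℝ) ≤ D := by exact_mod_cast hD1
  have hD0 : (0 : ℝ) < D := by linarith
  simp only [Real.rpow_zero, mul_one] at hd6 hd24 hdN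
  intro P h Ds hL D' hlo hhi
  replace hL := hL.mono hCC₁
  /- ── `Ds < D'`, `N₁ ≤ D'` ── -/
  have hD'0 : (0 : ℝ) ≤ D' := Nat.cast_nonneg _
  obtain ⟨hDsD', hlo4⟩ := lt_level_of_absorbRange h1 hc0 hC1 hcpow.le hD0 hD'0 (Nat.cast_nonneg Ds)
    hlo (hL.rpow_Ds_le h1.le hβ.le hC1 hd6)
  obtain ⟨hch, -, hpos, hne, hDs1, -, hcard, hh0, hh, hLiou, hmass, -⟩ := hL
  have hDs1r : (1 : ℝ) ≤ Ds := by exact_mod_cast hDs1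
  have hD'1r : (1 : ℝ) ≤ D' := by linarith
  have hD'1 : 1 ≤ D' := by exact_mod_cast hD'1r
  have hN₁D' : N₁ ≤ D' := by
    have h3 : (N₁ : ℝ) * c ≤ (D' : ℝ) * c := hdN.trans ((div_le_iff₀ hc0).mp hlo)
    exact_mod_cast le_of_mul_le_mul_right h3 hc0
  obtain ⟨hbig', hconst⟩ := hN₁ D' hN₁D'
  /- ── sizes at the level `D'` ── -/
  have hd1 : (1 : ℝ) ≤ #P := by exact_mod_cast hne.card_pos
  have hcard' : (#P : ℝ) ≤ C₁ * (D' : ℝ) ^ (2 - τ) :=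
    hcard.trans (mul_le_mul_of_nonneg_left
      (Real.rpow_le_rpow (Nat.cast_nonneg _) hDsD'.le (by linarith)) hC₁0.le)
  have hh' : h ≤ C₁ * (D' : ℝ) ^ (1 + β - τ) :=
    hh.trans (mul_le_mul_of_nonneg_left
      (Real.rpow_le_rpow (Nat.cast_nonneg _) hDsD'.le (by linarith)) hC₁0.le)
  /- ── the form `R`, the point `p₀`, Liouville, the sets `𝒰 ⊇ 𝒮` ── -/
  intro R hRh hRmem p₀ hp₀
  by_contra hne0
  obtain ⟨hall, hLio⟩ := hLiou D' R hRh ⟨p₀, hp₀, hne0⟩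
  obtain ⟨U, hU⟩ : ∃ U : Finset (Fin 3 → ℂ), U = P.filter (IsNear ξ η) := ⟨_, rfl⟩
  rw [← hU] at hmass
  obtain ⟨S, hS⟩ : ∃ S : Finset (Fin 3 → ℂ),
      S = U.filter (fun p => leafCloseness ξ η ⌊(D : ℝ) ^ τ⌋₊ p < 0) := ⟨_, rfl⟩
  have hSU : S ⊆ U := hS ▸ filter_subset _ _
  have hSU' : S ⊆ P.filter (IsNear ξ η) := hU ▸ hSU
  have hUnear : ∀ p ∈ U, IsNear ξ η p := fun p hp => by
    rw [hU] at hp; exact (mem_filter.mp hp).2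
  have hP0 : ∀ p ∈ P, p ≠ 0 := fun p hp h0 => hch p hp (by simp [h0])
  /- ── Step 4 at `D'`: `−∑_{𝒮} leafCloseness T' ≤ D' h + 6 #P (D')^β` ── -/
  have hstar :=
    absorb_neg_sum_leafCloseness_le hRmem hP0 hpos hall hLio hSU' hcard' hh' hbig' hconst
  /- ── the mass side at depth `T = ⌊D^τ⌋`: `∑_{𝒮} leafCloseness T ≤ ∑_{𝒰} ≤ −Mass` ── -/
  have hSsum : ∑ p ∈ S, leafCloseness ξ η ⌊(D : ℝ) ^ τ⌋₊ p ≤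
      -((D : ℝ) ^ δ / C₁ * ((D : ℝ) ^ β * #P + D * h)) := by
    have hsplit := sum_filter_add_sum_filter_not U
      (fun p => leafCloseness ξ η ⌊(D : ℝ) ^ τ⌋₊ p < 0)
      (fun p => leafCloseness ξ η ⌊(D : ℝ) ^ τ⌋₊ p)
    have hnn : 0 ≤ ∑ p ∈ U.filter (fun p => ¬ leafCloseness ξ η ⌊(D : ℝ) ^ τ⌋₊ p < 0),
        leafCloseness ξ η ⌊(D : ℝ) ^ τ⌋₊ p :=
      sum_nonneg fun p hp => not_lt.mp (mem_filter.mp hp).2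
    rw [hS]; linarith
  have hT1 : 1 ≤ ⌊(D : ℝ) ^ τ⌋₊ := one_le_natFloor_rpow hD1 hτ0
  have hT'1 : 1 ≤ ⌊(D' : ℝ) ^ τ⌋₊ := one_le_natFloor_rpow hD'1 hτ0
  rcases le_or_gt D' D with hle | hlt
  · /- below `D`: `T' ≤ T`, factor `ρ = T'/T` -/
    have hleR : (D' : ℝ) ≤ D := by exact_mod_cast hle
    have hTT : ⌊(D' : ℝ) ^ τ⌋₊ ≤ ⌊(D : ℝ) ^ τ⌋₊ :=
      Nat.floor_le_floor (Real.rpow_le_rpow hD'0 hleR hτ0)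
    have hρ0 : (0 : ℝ) ≤ ((⌊(D' : ℝ) ^ τ⌋₊ : ℕ) : ℝ) / (⌊(D : ℝ) ^ τ⌋₊ : ℕ) := by positivity
    have hsum' : ∑ p ∈ S, leafCloseness ξ η ⌊(D' : ℝ) ^ τ⌋₊ p ≤
        ((⌊(D' : ℝ) ^ τ⌋₊ : ℕ) : ℝ) / (⌊(D : ℝ) ^ τ⌋₊ : ℕ) *
          -((D : ℝ) ^ δ / C₁ * ((D : ℝ) ^ β * #P + D * h)) := by
      calc ∑ p ∈ S, leafCloseness ξ η ⌊(D' : ℝ) ^ τ⌋₊ p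
          ≤ ∑ p ∈ S, ((⌊(D' : ℝ) ^ τ⌋₊ : ℕ) : ℝ) / (⌊(D : ℝ) ^ τ⌋₊ : ℕ) *
              leafCloseness ξ η ⌊(D : ℝ) ^ τ⌋₊ p := by
            refine sum_le_sum fun p hp => leafCloseness_absorb_descent hT1 hTT ?_
            rw [hS] at hp; exact (mem_filter.mp hp).2
        _ = ((⌊(D' : ℝ) ^ τ⌋₊ : ℕ) : ℝ) / (⌊(D : ℝ) ^ τ⌋₊ : ℕ) *
              ∑ p ∈ S, leafCloseness ξ η ⌊(D : ℝ) ^ τ⌋₊ p := (mul_sum _ _ _).symm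
        _ ≤ _ := mul_le_mul_of_nonneg_left hSsum hρ0
    have hcontra := absorb_contra_down (β := β) hβ.le hC1 hD1r hD'1r hleR hlo4 hd24
      hd1 hh0 (by exact_mod_cast hT1) (natFloor_rpow_le D τ) (by exact_mod_cast hT'1)
      (rpow_le_two_mul_natFloor hD'1 hτ0)
    linarith
  · /- above `D`: `T ≤ T'`, factor `ρ = 1` -/
    have hTT : ⌊(D : ℝ) ^ τ⌋₊ ≤ ⌊(D' : ℝ) ^ τ⌋₊ :=
      Nat.floor_le_floor (Real.rpow_le_rpow hD0.le (by exact_mod_cast hlt.le) hτ0)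
    have hsum' : ∑ p ∈ S, leafCloseness ξ η ⌊(D' : ℝ) ^ τ⌋₊ p ≤
        -((D : ℝ) ^ δ / C₁ * ((D : ℝ) ^ β * #P + D * h)) :=
      (sum_le_sum fun p hp => leafCloseness_absorb_ascent hTT (hUnear p (hSU hp))).trans hSsum
    have hcontra := absorb_contra_up hC1 hc0 hc12 hβ1.le hδ hD1r hD'0 hhi hd1 hh0
    linarith

end Summit.Schanuel.Schanuel.Theorems.RoyLinks

end
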